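import Summits.Ventures.CertifiedManyBodySolver.Downfold.EmeryAxialSlabTl2223OPSubsA
import Summits.Ventures.CertifiedManyBodySolver.Downfold.EmeryAxialSlabTl2223OPSubsB
import Summits.Ventures.CertifiedManyBodySolver.Downfold.EmeryAxialSlabTl2223OPSubsC
import Summits.Ventures.CertifiedManyBodySolver.Downfold.EmeryFermiFillingLa214
import HarnessLib

/-!
# Tl₂Ba₂Ca₂Cu₃O₁₀ OUTER plane (box #306 Tl-2223, (K) source rows): HOW MUCH AXIAL (Cu-4s / apical) ADMIXTURE DOES THE BOX'S ONE-BAND FERMI SURFACE REQUIRE? — the certified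
# co-shift census of the typed 3BE one-body box `emeryBoxTl2223OPK15Src` against its object-E row `t′/t ∈ [-0.432, -0.331]`

Venture CertifiedManyBodySolver, cell `pub/hubbard-downfold` (stage S1, HUMAN RULINGS D-0096/D-0098: the 3 → 1 reduction error is carried explicitly),
seat hubbard-downfold-mod-4 (technique B = band level); namespace `Summit.Ventures.CertifiedManyBodySolver.Downfold.Emery`. Everything PROVED; numerics
decided by the kernel in `EmeryAxialSlabTl2223OPSubsA`, `EmeryAxialSlabTl2223OPSubsB`, `EmeryAxialSlabTl2223OPSubsC`.

CONTEXT. `EmeryFermiFillingTl2223OP…` certified the σ three-band (d–p_x–p_y + t_pp, t_pp′) Fermi-surface `t′/t` window of this box at its own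
hole count and compared it with the box's object-E row (router/BOXES/Tl2Ba2Ca2Cu3O10.md l.25 «tp/t (E) @Cu-OP [−0.432, −0.331]»). `EmeryAxialFermiSurfaceShape` +
`EmeryAxialConductionBand` (TRANSFER THEOREM `condBand_le_iff`, no separation hypothesis) prove that the four-orbital model of [AndersenEtAl1995] /
[PavariniEtAl2001] — Cu-4s (and through it the apical orbitals) added to the σ model — has, AT ITS FERMI LEVEL, exactly the conduction-band occupied
set, filling and Fermi surface of the σ model with CO-SHIFTED O–O hoppings `(t_pp + a, t_pp′ + a)`, ONE scalar `a = a_F = t_sp²/(ε_s − ε_F) ≥ 0`.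
So «how much axial channel does the one-band FS of record require beyond the box's σ rows?» is a one-parameter question, answered here slab by slab
(sub-box rule version B, `EmeryFermiFillingSubBoxB`; edges 0, 0.02, 0.05, 0.1, 0.2, 0.25, 0.3, 0.35, 0.4, 0.5 eV; Δ_pd × t_pd split 2 × 2):

| slab | a (eV) | ε_F window (eV above ε_d) | certified t′/t window | vs E row [-0.432, -0.331] |
|---|---|---|---|---|
| 0 | [0, 0.02] | [1.16, 2.24] | [-0.3364, -0.2503] | MEETS |
| 1 | [0.02, 0.05] | [1.14, 2.22] | [-0.35, -0.2598] | MEETS |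
| 2 | [0.05, 0.1] | [1.12, 2.22] | [-0.371, -0.2736] | MEETS |
| 3 | [0.1, 0.2] | [1.06, 2.22] | [-0.4091, -0.2936] | MEETS |
| 4 | [0.2, 0.25] | [1.06, 2.14] | [-0.4237, -0.3254] | MEETS |
| 5 | [0.25, 0.3] | [1.04, 2.12] | [-0.4374, -0.339] | MEETS |
| 6 | [0.3, 0.35] | [1.04, 2.1] | [-0.4517, -0.3513] | MEETS |
| 7 | [0.35, 0.4] | [1.02, 2.08] | [-0.464, -0.363] | MEETS |
| 8 | [0.4, 0.5] | [0.98, 2.1] | [-0.4883, -0.3722] | MEETS |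

READING (certified, numbers not adjectives): every slab MEETS the E row (no exclusion certified at this resolution). The four-orbital form of the exclusion(s) is `emeryBoxTl2223OPK15Src_fourOrbital_short`:
for ANY axial level `ε_s` and coupling `t_sp`, a four-orbital completion of a box point whose conduction band holds the box's electrons at a Fermi level `ε_F < ε_s`
with `t_sp²/(ε_s − ε_F)` in the excluded range does NOT reproduce the E row. (Pavarini's range parameter for the PURE four-orbital model is
`r = ½/(1 + s)`, `s = (ε_s − ε_F)(ε_F − ε_p)/(2t_sp)² = (ε_F + Δ_pd)/(4·a_total)`, where `a_total` would be the WHOLE O–O co-shift; the box's `t_pp, t_pp′` rows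
already contain part of the axial channel when they come from a three-band Wannier fit, so `a_F` here is the ADDITIONAL admixture — a model-form
distance, not a material constant.)

WHAT THIS IS NOT: not a statement that the material's parameters ARE in the box (SCREENING-GRADE provenance); `U = 0` band kinematics; no phase
sentence; the E row is a [float] literature refit. Sources: [AndersenEtAl1995, §§5–6]; [PavariniEtAl2001, Eqs. (1)–(3), Fig. 3];
[HybertsenSchluterChristensen1989, Eq. (1)].
-/

noncomputable section

namespace Summit.Ventures.CertifiedManyBodySolver.Downfold.Emery

open Real Set
open Summit.Ventures.CertifiedManyBodySolver.Downfold

/-! ## §1 Slab windows (raw co-shifted coordinates `t_pp′ := t_pp + a`, `c′ := t_pp′ + a`) -/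

/-- **Slab 0, a ∈ [0, 0.02] eV**: on the co-shifted box (t_pp + a ∈ [0.61, 0.74], t_pp′ + a ∈ [0.15, 0.2]) at per-spin
filling ∈ [0.41, 0.43]: `ε_F ∈ [1.16, 2.24]` and `t′/t ∈ [-0.3364, -0.2503]` — MEETS vs the E row. [folklore] -/
theorem tl2223OPAxSlab0_window {Δ tpd tpp c ε : ℝ} (hΔ : Δ ∈ Set.Icc (81 / 50 : ℝ) (239 / 100 : ℝ))
    (ha : tpd ∈ Set.Icc (59 / 50 : ℝ) (139 / 100 : ℝ)) (hb : tpp ∈ Set.Icc (61 / 100 : ℝ) (37 / 50 : ℝ))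
    (hc : c ∈ Set.Icc (3 / 20 : ℝ) (1 / 5 : ℝ))
    (hν : abFilling Δ tpd tpp c ε ∈ Set.Icc (41 / 100 : ℝ) (43 / 100 : ℝ)) :
    ε ∈ Set.Icc (29 / 25 : ℝ) (56 / 25 : ℝ) ∧ fsRatio Δ tpd tpp c ε ∈ Set.Icc (-(841 / 2500 : ℝ)) (-(2503 / 10000 : ℝ)) := by
  have hΔ' := hΔ
  constructor
  · clear hΔ
    rcases mem_Icc_split hΔ' (401 / 200 : ℝ) with hΔ' | hΔ'
    · rcases mem_Icc_split ha (257 / 200 : ℝ) with ha' | ha'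
      · have h := (tl2223OPAx0Sub_0_0 hΔ' ha' hb hc hν).1
        exact ⟨le_trans (by norm_num) h.1, h.2.trans (by norm_num)⟩
      · have h := (tl2223OPAx0Sub_0_1 hΔ' ha' hb hc hν).1
        exact ⟨le_trans (by norm_num) h.1, h.2.trans (by norm_num)⟩
    · rcases mem_Icc_split ha (257 / 200 : ℝ) with ha' | ha'
      · have h := (tl2223OPAx0Sub_1_0 hΔ' ha' hb hc hν).1
        exact ⟨le_trans (by norm_num) h.1, h.2.trans (by norm_num)⟩
      · have h := (tl2223OPAx0Sub_1_1 hΔ' ha' hb hc hν).1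
        exact ⟨le_trans (by norm_num) h.1, h.2.trans (by norm_num)⟩
  · clear hΔ
    rcases mem_Icc_split hΔ' (401 / 200 : ℝ) with hΔ' | hΔ'
    · rcases mem_Icc_split ha (257 / 200 : ℝ) with ha' | ha'
      · have h := (tl2223OPAx0Sub_0_0 hΔ' ha' hb hc hν).2
        exact ⟨le_trans (by norm_num) h.1, h.2.trans (by norm_num)⟩
      · have h := (tl2223OPAx0Sub_0_1 hΔ' ha' hb hc hν).2
        exact ⟨le_trans (by norm_num) h.1, h.2.trans (by norm_num)⟩
    · rcases mem_Icc_split ha (257 / 200 : ℝ) with ha' | ha'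
      · have h := (tl2223OPAx0Sub_1_0 hΔ' ha' hb hc hν).2
        exact ⟨le_trans (by norm_num) h.1, h.2.trans (by norm_num)⟩
      · have h := (tl2223OPAx0Sub_1_1 hΔ' ha' hb hc hν).2
        exact ⟨le_trans (by norm_num) h.1, h.2.trans (by norm_num)⟩

/-- **Slab 1, a ∈ [0.02, 0.05] eV**: on the co-shifted box (t_pp + a ∈ [0.63, 0.77], t_pp′ + a ∈ [0.17, 0.23]) at per-spin
filling ∈ [0.41, 0.43]: `ε_F ∈ [1.14, 2.22]` and `t′/t ∈ [-0.35, -0.2598]` — MEETS vs the E row. [folklore] -/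
theorem tl2223OPAxSlab1_window {Δ tpd tpp c ε : ℝ} (hΔ : Δ ∈ Set.Icc (81 / 50 : ℝ) (239 / 100 : ℝ))
    (ha : tpd ∈ Set.Icc (59 / 50 : ℝ) (139 / 100 : ℝ)) (hb : tpp ∈ Set.Icc (63 / 100 : ℝ) (77 / 100 : ℝ))
    (hc : c ∈ Set.Icc (17 / 100 : ℝ) (23 / 100 : ℝ))
    (hν : abFilling Δ tpd tpp c ε ∈ Set.Icc (41 / 100 : ℝ) (43 / 100 : ℝ)) :
    ε ∈ Set.Icc (57 / 50 : ℝ) (111 / 50 : ℝ) ∧ fsRatio Δ tpd tpp c ε ∈ Set.Icc (-(7 / 20 : ℝ)) (-(1299 / 5000 : ℝ)) := by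
  have hΔ' := hΔ
  constructor
  · clear hΔ
    rcases mem_Icc_split hΔ' (401 / 200 : ℝ) with hΔ' | hΔ'
    · rcases mem_Icc_split ha (257 / 200 : ℝ) with ha' | ha'
      · have h := (tl2223OPAx1Sub_0_0 hΔ' ha' hb hc hν).1
        exact ⟨le_trans (by norm_num) h.1, h.2.trans (by norm_num)⟩
      · have h := (tl2223OPAx1Sub_0_1 hΔ' ha' hb hc hν).1
        exact ⟨le_trans (by norm_num) h.1, h.2.trans (by norm_num)⟩
    · rcases mem_Icc_split ha (257 / 200 : ℝ) with ha' | ha'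
      · have h := (tl2223OPAx1Sub_1_0 hΔ' ha' hb hc hν).1
        exact ⟨le_trans (by norm_num) h.1, h.2.trans (by norm_num)⟩
      · have h := (tl2223OPAx1Sub_1_1 hΔ' ha' hb hc hν).1
        exact ⟨le_trans (by norm_num) h.1, h.2.trans (by norm_num)⟩
  · clear hΔ
    rcases mem_Icc_split hΔ' (401 / 200 : ℝ) with hΔ' | hΔ'
    · rcases mem_Icc_split ha (257 / 200 : ℝ) with ha' | ha'
      · have h := (tl2223OPAx1Sub_0_0 hΔ' ha' hb hc hν).2
        exact ⟨le_trans (by norm_num) h.1, h.2.trans (by norm_num)⟩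
      · have h := (tl2223OPAx1Sub_0_1 hΔ' ha' hb hc hν).2
        exact ⟨le_trans (by norm_num) h.1, h.2.trans (by norm_num)⟩
    · rcases mem_Icc_split ha (257 / 200 : ℝ) with ha' | ha'
      · have h := (tl2223OPAx1Sub_1_0 hΔ' ha' hb hc hν).2
        exact ⟨le_trans (by norm_num) h.1, h.2.trans (by norm_num)⟩
      · have h := (tl2223OPAx1Sub_1_1 hΔ' ha' hb hc hν).2
        exact ⟨le_trans (by norm_num) h.1, h.2.trans (by norm_num)⟩

/-- **Slab 2, a ∈ [0.05, 0.1] eV**: on the co-shifted box (t_pp + a ∈ [0.66, 0.82], t_pp′ + a ∈ [0.2, 0.28]) at per-spin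
filling ∈ [0.41, 0.43]: `ε_F ∈ [1.12, 2.22]` and `t′/t ∈ [-0.371, -0.2736]` — MEETS vs the E row. [folklore] -/
theorem tl2223OPAxSlab2_window {Δ tpd tpp c ε : ℝ} (hΔ : Δ ∈ Set.Icc (81 / 50 : ℝ) (239 / 100 : ℝ))
    (ha : tpd ∈ Set.Icc (59 / 50 : ℝ) (139 / 100 : ℝ)) (hb : tpp ∈ Set.Icc (33 / 50 : ℝ) (41 / 50 : ℝ))
    (hc : c ∈ Set.Icc (1 / 5 : ℝ) (7 / 25 : ℝ))
    (hν : abFilling Δ tpd tpp c ε ∈ Set.Icc (41 / 100 : ℝ) (43 / 100 : ℝ)) :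
    ε ∈ Set.Icc (28 / 25 : ℝ) (111 / 50 : ℝ) ∧ fsRatio Δ tpd tpp c ε ∈ Set.Icc (-(371 / 1000 : ℝ)) (-(171 / 625 : ℝ)) := by
  have hΔ' := hΔ
  constructor
  · clear hΔ
    rcases mem_Icc_split hΔ' (401 / 200 : ℝ) with hΔ' | hΔ'
    · rcases mem_Icc_split ha (257 / 200 : ℝ) with ha' | ha'
      · have h := (tl2223OPAx2Sub_0_0 hΔ' ha' hb hc hν).1
        exact ⟨le_trans (by norm_num) h.1, h.2.trans (by norm_num)⟩
      · have h := (tl2223OPAx2Sub_0_1 hΔ' ha' hb hc hν).1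
        exact ⟨le_trans (by norm_num) h.1, h.2.trans (by norm_num)⟩
    · rcases mem_Icc_split ha (257 / 200 : ℝ) with ha' | ha'
      · have h := (tl2223OPAx2Sub_1_0 hΔ' ha' hb hc hν).1
        exact ⟨le_trans (by norm_num) h.1, h.2.trans (by norm_num)⟩
      · have h := (tl2223OPAx2Sub_1_1 hΔ' ha' hb hc hν).1
        exact ⟨le_trans (by norm_num) h.1, h.2.trans (by norm_num)⟩
  · clear hΔ
    rcases mem_Icc_split hΔ' (401 / 200 : ℝ) with hΔ' | hΔ'
    · rcases mem_Icc_split ha (257 / 200 : ℝ) with ha' | ha'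
      · have h := (tl2223OPAx2Sub_0_0 hΔ' ha' hb hc hν).2
        exact ⟨le_trans (by norm_num) h.1, h.2.trans (by norm_num)⟩
      · have h := (tl2223OPAx2Sub_0_1 hΔ' ha' hb hc hν).2
        exact ⟨le_trans (by norm_num) h.1, h.2.trans (by norm_num)⟩
    · rcases mem_Icc_split ha (257 / 200 : ℝ) with ha' | ha'
      · have h := (tl2223OPAx2Sub_1_0 hΔ' ha' hb hc hν).2
        exact ⟨le_trans (by norm_num) h.1, h.2.trans (by norm_num)⟩
      · have h := (tl2223OPAx2Sub_1_1 hΔ' ha' hb hc hν).2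
        exact ⟨le_trans (by norm_num) h.1, h.2.trans (by norm_num)⟩

/-- **Slab 3, a ∈ [0.1, 0.2] eV**: on the co-shifted box (t_pp + a ∈ [0.71, 0.92], t_pp′ + a ∈ [0.25, 0.38]) at per-spin
filling ∈ [0.41, 0.43]: `ε_F ∈ [1.06, 2.22]` and `t′/t ∈ [-0.4091, -0.2936]` — MEETS vs the E row. [folklore] -/
theorem tl2223OPAxSlab3_window {Δ tpd tpp c ε : ℝ} (hΔ : Δ ∈ Set.Icc (81 / 50 : ℝ) (239 / 100 : ℝ))
    (ha : tpd ∈ Set.Icc (59 / 50 : ℝ) (139 / 100 : ℝ)) (hb : tpp ∈ Set.Icc (71 / 100 : ℝ) (23 / 25 : ℝ))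
    (hc : c ∈ Set.Icc (1 / 4 : ℝ) (19 / 50 : ℝ))
    (hν : abFilling Δ tpd tpp c ε ∈ Set.Icc (41 / 100 : ℝ) (43 / 100 : ℝ)) :
    ε ∈ Set.Icc (53 / 50 : ℝ) (111 / 50 : ℝ) ∧ fsRatio Δ tpd tpp c ε ∈ Set.Icc (-(4091 / 10000 : ℝ)) (-(367 / 1250 : ℝ)) := by
  have hΔ' := hΔ
  constructor
  · clear hΔ
    rcases mem_Icc_split hΔ' (401 / 200 : ℝ) with hΔ' | hΔ'
    · rcases mem_Icc_split ha (257 / 200 : ℝ) with ha' | ha'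
      · have h := (tl2223OPAx3Sub_0_0 hΔ' ha' hb hc hν).1
        exact ⟨le_trans (by norm_num) h.1, h.2.trans (by norm_num)⟩
      · have h := (tl2223OPAx3Sub_0_1 hΔ' ha' hb hc hν).1
        exact ⟨le_trans (by norm_num) h.1, h.2.trans (by norm_num)⟩
    · rcases mem_Icc_split ha (257 / 200 : ℝ) with ha' | ha'
      · have h := (tl2223OPAx3Sub_1_0 hΔ' ha' hb hc hν).1
        exact ⟨le_trans (by norm_num) h.1, h.2.trans (by norm_num)⟩
      · have h := (tl2223OPAx3Sub_1_1 hΔ' ha' hb hc hν).1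
        exact ⟨le_trans (by norm_num) h.1, h.2.trans (by norm_num)⟩
  · clear hΔ
    rcases mem_Icc_split hΔ' (401 / 200 : ℝ) with hΔ' | hΔ'
    · rcases mem_Icc_split ha (257 / 200 : ℝ) with ha' | ha'
      · have h := (tl2223OPAx3Sub_0_0 hΔ' ha' hb hc hν).2
        exact ⟨le_trans (by norm_num) h.1, h.2.trans (by norm_num)⟩
      · have h := (tl2223OPAx3Sub_0_1 hΔ' ha' hb hc hν).2
        exact ⟨le_trans (by norm_num) h.1, h.2.trans (by norm_num)⟩
    · rcases mem_Icc_split ha (257 / 200 : ℝ) with ha' | ha'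
      · have h := (tl2223OPAx3Sub_1_0 hΔ' ha' hb hc hν).2
        exact ⟨le_trans (by norm_num) h.1, h.2.trans (by norm_num)⟩
      · have h := (tl2223OPAx3Sub_1_1 hΔ' ha' hb hc hν).2
        exact ⟨le_trans (by norm_num) h.1, h.2.trans (by norm_num)⟩

/-- **Slab 4, a ∈ [0.2, 0.25] eV**: on the co-shifted box (t_pp + a ∈ [0.81, 0.97], t_pp′ + a ∈ [0.35, 0.43]) at per-spin
filling ∈ [0.41, 0.43]: `ε_F ∈ [1.06, 2.14]` and `t′/t ∈ [-0.4237, -0.3254]` — MEETS vs the E row. [folklore] -/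
theorem tl2223OPAxSlab4_window {Δ tpd tpp c ε : ℝ} (hΔ : Δ ∈ Set.Icc (81 / 50 : ℝ) (239 / 100 : ℝ))
    (ha : tpd ∈ Set.Icc (59 / 50 : ℝ) (139 / 100 : ℝ)) (hb : tpp ∈ Set.Icc (81 / 100 : ℝ) (97 / 100 : ℝ))
    (hc : c ∈ Set.Icc (7 / 20 : ℝ) (43 / 100 : ℝ))
    (hν : abFilling Δ tpd tpp c ε ∈ Set.Icc (41 / 100 : ℝ) (43 / 100 : ℝ)) :
    ε ∈ Set.Icc (53 / 50 : ℝ) (107 / 50 : ℝ) ∧ fsRatio Δ tpd tpp c ε ∈ Set.Icc (-(4237 / 10000 : ℝ)) (-(1627 / 5000 : ℝ)) := by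
  have hΔ' := hΔ
  constructor
  · clear hΔ
    rcases mem_Icc_split hΔ' (401 / 200 : ℝ) with hΔ' | hΔ'
    · rcases mem_Icc_split ha (257 / 200 : ℝ) with ha' | ha'
      · have h := (tl2223OPAx4Sub_0_0 hΔ' ha' hb hc hν).1
        exact ⟨le_trans (by norm_num) h.1, h.2.trans (by norm_num)⟩
      · have h := (tl2223OPAx4Sub_0_1 hΔ' ha' hb hc hν).1
        exact ⟨le_trans (by norm_num) h.1, h.2.trans (by norm_num)⟩
    · rcases mem_Icc_split ha (257 / 200 : ℝ) with ha' | ha'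
      · have h := (tl2223OPAx4Sub_1_0 hΔ' ha' hb hc hν).1
        exact ⟨le_trans (by norm_num) h.1, h.2.trans (by norm_num)⟩
      · have h := (tl2223OPAx4Sub_1_1 hΔ' ha' hb hc hν).1
        exact ⟨le_trans (by norm_num) h.1, h.2.trans (by norm_num)⟩
  · clear hΔ
    rcases mem_Icc_split hΔ' (401 / 200 : ℝ) with hΔ' | hΔ'
    · rcases mem_Icc_split ha (257 / 200 : ℝ) with ha' | ha'
      · have h := (tl2223OPAx4Sub_0_0 hΔ' ha' hb hc hν).2
        exact ⟨le_trans (by norm_num) h.1, h.2.trans (by norm_num)⟩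
      · have h := (tl2223OPAx4Sub_0_1 hΔ' ha' hb hc hν).2
        exact ⟨le_trans (by norm_num) h.1, h.2.trans (by norm_num)⟩
    · rcases mem_Icc_split ha (257 / 200 : ℝ) with ha' | ha'
      · have h := (tl2223OPAx4Sub_1_0 hΔ' ha' hb hc hν).2
        exact ⟨le_trans (by norm_num) h.1, h.2.trans (by norm_num)⟩
      · have h := (tl2223OPAx4Sub_1_1 hΔ' ha' hb hc hν).2
        exact ⟨le_trans (by norm_num) h.1, h.2.trans (by norm_num)⟩

/-- **Slab 5, a ∈ [0.25, 0.3] eV**: on the co-shifted box (t_pp + a ∈ [0.86, 1.02], t_pp′ + a ∈ [0.4, 0.48]) at per-spin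
filling ∈ [0.41, 0.43]: `ε_F ∈ [1.04, 2.12]` and `t′/t ∈ [-0.4374, -0.339]` — MEETS vs the E row. [folklore] -/
theorem tl2223OPAxSlab5_window {Δ tpd tpp c ε : ℝ} (hΔ : Δ ∈ Set.Icc (81 / 50 : ℝ) (239 / 100 : ℝ))
    (ha : tpd ∈ Set.Icc (59 / 50 : ℝ) (139 / 100 : ℝ)) (hb : tpp ∈ Set.Icc (43 / 50 : ℝ) (51 / 50 : ℝ))
    (hc : c ∈ Set.Icc (2 / 5 : ℝ) (12 / 25 : ℝ))
    (hν : abFilling Δ tpd tpp c ε ∈ Set.Icc (41 / 100 : ℝ) (43 / 100 : ℝ)) :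
    ε ∈ Set.Icc (26 / 25 : ℝ) (53 / 25 : ℝ) ∧ fsRatio Δ tpd tpp c ε ∈ Set.Icc (-(2187 / 5000 : ℝ)) (-(339 / 1000 : ℝ)) := by
  have hΔ' := hΔ
  constructor
  · clear hΔ
    rcases mem_Icc_split hΔ' (401 / 200 : ℝ) with hΔ' | hΔ'
    · rcases mem_Icc_split ha (257 / 200 : ℝ) with ha' | ha'
      · have h := (tl2223OPAx5Sub_0_0 hΔ' ha' hb hc hν).1
        exact ⟨le_trans (by norm_num) h.1, h.2.trans (by norm_num)⟩
      · have h := (tl2223OPAx5Sub_0_1 hΔ' ha' hb hc hν).1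
        exact ⟨le_trans (by norm_num) h.1, h.2.trans (by norm_num)⟩
    · rcases mem_Icc_split ha (257 / 200 : ℝ) with ha' | ha'
      · have h := (tl2223OPAx5Sub_1_0 hΔ' ha' hb hc hν).1
        exact ⟨le_trans (by norm_num) h.1, h.2.trans (by norm_num)⟩
      · have h := (tl2223OPAx5Sub_1_1 hΔ' ha' hb hc hν).1
        exact ⟨le_trans (by norm_num) h.1, h.2.trans (by norm_num)⟩
  · clear hΔ
    rcases mem_Icc_split hΔ' (401 / 200 : ℝ) with hΔ' | hΔ'
    · rcases mem_Icc_split ha (257 / 200 : ℝ) with ha' | ha'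
      · have h := (tl2223OPAx5Sub_0_0 hΔ' ha' hb hc hν).2
        exact ⟨le_trans (by norm_num) h.1, h.2.trans (by norm_num)⟩
      · have h := (tl2223OPAx5Sub_0_1 hΔ' ha' hb hc hν).2
        exact ⟨le_trans (by norm_num) h.1, h.2.trans (by norm_num)⟩
    · rcases mem_Icc_split ha (257 / 200 : ℝ) with ha' | ha'
      · have h := (tl2223OPAx5Sub_1_0 hΔ' ha' hb hc hν).2
        exact ⟨le_trans (by norm_num) h.1, h.2.trans (by norm_num)⟩
      · have h := (tl2223OPAx5Sub_1_1 hΔ' ha' hb hc hν).2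
        exact ⟨le_trans (by norm_num) h.1, h.2.trans (by norm_num)⟩

/-- **Slab 6, a ∈ [0.3, 0.35] eV**: on the co-shifted box (t_pp + a ∈ [0.91, 1.07], t_pp′ + a ∈ [0.45, 0.53]) at per-spin
filling ∈ [0.41, 0.43]: `ε_F ∈ [1.04, 2.1]` and `t′/t ∈ [-0.4517, -0.3513]` — MEETS vs the E row. [folklore] -/
theorem tl2223OPAxSlab6_window {Δ tpd tpp c ε : ℝ} (hΔ : Δ ∈ Set.Icc (81 / 50 : ℝ) (239 / 100 : ℝ))
    (ha : tpd ∈ Set.Icc (59 / 50 : ℝ) (139 / 100 : ℝ)) (hb : tpp ∈ Set.Icc (91 / 100 : ℝ) (107 / 100 : ℝ))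
    (hc : c ∈ Set.Icc (9 / 20 : ℝ) (53 / 100 : ℝ))
    (hν : abFilling Δ tpd tpp c ε ∈ Set.Icc (41 / 100 : ℝ) (43 / 100 : ℝ)) :
    ε ∈ Set.Icc (26 / 25 : ℝ) (21 / 10 : ℝ) ∧ fsRatio Δ tpd tpp c ε ∈ Set.Icc (-(4517 / 10000 : ℝ)) (-(3513 / 10000 : ℝ)) := by
  have hΔ' := hΔ
  constructor
  · clear hΔ
    rcases mem_Icc_split hΔ' (401 / 200 : ℝ) with hΔ' | hΔ'
    · rcases mem_Icc_split ha (257 / 200 : ℝ) with ha' | ha'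
      · have h := (tl2223OPAx6Sub_0_0 hΔ' ha' hb hc hν).1
        exact ⟨le_trans (by norm_num) h.1, h.2.trans (by norm_num)⟩
      · have h := (tl2223OPAx6Sub_0_1 hΔ' ha' hb hc hν).1
        exact ⟨le_trans (by norm_num) h.1, h.2.trans (by norm_num)⟩
    · rcases mem_Icc_split ha (257 / 200 : ℝ) with ha' | ha'
      · have h := (tl2223OPAx6Sub_1_0 hΔ' ha' hb hc hν).1
        exact ⟨le_trans (by norm_num) h.1, h.2.trans (by norm_num)⟩
      · have h := (tl2223OPAx6Sub_1_1 hΔ' ha' hb hc hν).1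
        exact ⟨le_trans (by norm_num) h.1, h.2.trans (by norm_num)⟩
  · clear hΔ
    rcases mem_Icc_split hΔ' (401 / 200 : ℝ) with hΔ' | hΔ'
    · rcases mem_Icc_split ha (257 / 200 : ℝ) with ha' | ha'
      · have h := (tl2223OPAx6Sub_0_0 hΔ' ha' hb hc hν).2
        exact ⟨le_trans (by norm_num) h.1, h.2.trans (by norm_num)⟩
      · have h := (tl2223OPAx6Sub_0_1 hΔ' ha' hb hc hν).2
        exact ⟨le_trans (by norm_num) h.1, h.2.trans (by norm_num)⟩
    · rcases mem_Icc_split ha (257 / 200 : ℝ) with ha' | ha'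
      · have h := (tl2223OPAx6Sub_1_0 hΔ' ha' hb hc hν).2
        exact ⟨le_trans (by norm_num) h.1, h.2.trans (by norm_num)⟩
      · have h := (tl2223OPAx6Sub_1_1 hΔ' ha' hb hc hν).2
        exact ⟨le_trans (by norm_num) h.1, h.2.trans (by norm_num)⟩

/-- **Slab 7, a ∈ [0.35, 0.4] eV**: on the co-shifted box (t_pp + a ∈ [0.96, 1.12], t_pp′ + a ∈ [0.5, 0.58]) at per-spin
filling ∈ [0.41, 0.43]: `ε_F ∈ [1.02, 2.08]` and `t′/t ∈ [-0.464, -0.363]` — MEETS vs the E row. [folklore] -/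
theorem tl2223OPAxSlab7_window {Δ tpd tpp c ε : ℝ} (hΔ : Δ ∈ Set.Icc (81 / 50 : ℝ) (239 / 100 : ℝ))
    (ha : tpd ∈ Set.Icc (59 / 50 : ℝ) (139 / 100 : ℝ)) (hb : tpp ∈ Set.Icc (24 / 25 : ℝ) (28 / 25 : ℝ))
    (hc : c ∈ Set.Icc (1 / 2 : ℝ) (29 / 50 : ℝ))
    (hν : abFilling Δ tpd tpp c ε ∈ Set.Icc (41 / 100 : ℝ) (43 / 100 : ℝ)) :
    ε ∈ Set.Icc (51 / 50 : ℝ) (52 / 25 : ℝ) ∧ fsRatio Δ tpd tpp c ε ∈ Set.Icc (-(58 / 125 : ℝ)) (-(363 / 1000 : ℝ)) := by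
  have hΔ' := hΔ
  constructor
  · clear hΔ
    rcases mem_Icc_split hΔ' (401 / 200 : ℝ) with hΔ' | hΔ'
    · rcases mem_Icc_split ha (257 / 200 : ℝ) with ha' | ha'
      · have h := (tl2223OPAx7Sub_0_0 hΔ' ha' hb hc hν).1
        exact ⟨le_trans (by norm_num) h.1, h.2.trans (by norm_num)⟩
      · have h := (tl2223OPAx7Sub_0_1 hΔ' ha' hb hc hν).1
        exact ⟨le_trans (by norm_num) h.1, h.2.trans (by norm_num)⟩
    · rcases mem_Icc_split ha (257 / 200 : ℝ) with ha' | ha'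
      · have h := (tl2223OPAx7Sub_1_0 hΔ' ha' hb hc hν).1
        exact ⟨le_trans (by norm_num) h.1, h.2.trans (by norm_num)⟩
      · have h := (tl2223OPAx7Sub_1_1 hΔ' ha' hb hc hν).1
        exact ⟨le_trans (by norm_num) h.1, h.2.trans (by norm_num)⟩
  · clear hΔ
    rcases mem_Icc_split hΔ' (401 / 200 : ℝ) with hΔ' | hΔ'
    · rcases mem_Icc_split ha (257 / 200 : ℝ) with ha' | ha'
      · have h := (tl2223OPAx7Sub_0_0 hΔ' ha' hb hc hν).2
        exact ⟨le_trans (by norm_num) h.1, h.2.trans (by norm_num)⟩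
      · have h := (tl2223OPAx7Sub_0_1 hΔ' ha' hb hc hν).2
        exact ⟨le_trans (by norm_num) h.1, h.2.trans (by norm_num)⟩
    · rcases mem_Icc_split ha (257 / 200 : ℝ) with ha' | ha'
      · have h := (tl2223OPAx7Sub_1_0 hΔ' ha' hb hc hν).2
        exact ⟨le_trans (by norm_num) h.1, h.2.trans (by norm_num)⟩
      · have h := (tl2223OPAx7Sub_1_1 hΔ' ha' hb hc hν).2
        exact ⟨le_trans (by norm_num) h.1, h.2.trans (by norm_num)⟩

/-- **Slab 8, a ∈ [0.4, 0.5] eV**: on the co-shifted box (t_pp + a ∈ [1.01, 1.22], t_pp′ + a ∈ [0.55, 0.68]) at per-spin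
filling ∈ [0.41, 0.43]: `ε_F ∈ [0.98, 2.1]` and `t′/t ∈ [-0.4883, -0.3722]` — MEETS vs the E row. [folklore] -/
theorem tl2223OPAxSlab8_window {Δ tpd tpp c ε : ℝ} (hΔ : Δ ∈ Set.Icc (81 / 50 : ℝ) (239 / 100 : ℝ))
    (ha : tpd ∈ Set.Icc (59 / 50 : ℝ) (139 / 100 : ℝ)) (hb : tpp ∈ Set.Icc (101 / 100 : ℝ) (61 / 50 : ℝ))
    (hc : c ∈ Set.Icc (11 / 20 : ℝ) (17 / 25 : ℝ))
    (hν : abFilling Δ tpd tpp c ε ∈ Set.Icc (41 / 100 : ℝ) (43 / 100 : ℝ)) :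
    ε ∈ Set.Icc (49 / 50 : ℝ) (21 / 10 : ℝ) ∧ fsRatio Δ tpd tpp c ε ∈ Set.Icc (-(4883 / 10000 : ℝ)) (-(1861 / 5000 : ℝ)) := by
  have hΔ' := hΔ
  constructor
  · clear hΔ
    rcases mem_Icc_split hΔ' (401 / 200 : ℝ) with hΔ' | hΔ'
    · rcases mem_Icc_split ha (257 / 200 : ℝ) with ha' | ha'
      · have h := (tl2223OPAx8Sub_0_0 hΔ' ha' hb hc hν).1
        exact ⟨le_trans (by norm_num) h.1, h.2.trans (by norm_num)⟩
      · have h := (tl2223OPAx8Sub_0_1 hΔ' ha' hb hc hν).1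
        exact ⟨le_trans (by norm_num) h.1, h.2.trans (by norm_num)⟩
    · rcases mem_Icc_split ha (257 / 200 : ℝ) with ha' | ha'
      · have h := (tl2223OPAx8Sub_1_0 hΔ' ha' hb hc hν).1
        exact ⟨le_trans (by norm_num) h.1, h.2.trans (by norm_num)⟩
      · have h := (tl2223OPAx8Sub_1_1 hΔ' ha' hb hc hν).1
        exact ⟨le_trans (by norm_num) h.1, h.2.trans (by norm_num)⟩
  · clear hΔ
    rcases mem_Icc_split hΔ' (401 / 200 : ℝ) with hΔ' | hΔ'
    · rcases mem_Icc_split ha (257 / 200 : ℝ) with ha' | ha'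
      · have h := (tl2223OPAx8Sub_0_0 hΔ' ha' hb hc hν).2
        exact ⟨le_trans (by norm_num) h.1, h.2.trans (by norm_num)⟩
      · have h := (tl2223OPAx8Sub_0_1 hΔ' ha' hb hc hν).2
        exact ⟨le_trans (by norm_num) h.1, h.2.trans (by norm_num)⟩
    · rcases mem_Icc_split ha (257 / 200 : ℝ) with ha' | ha'
      · have h := (tl2223OPAx8Sub_1_0 hΔ' ha' hb hc hν).2
        exact ⟨le_trans (by norm_num) h.1, h.2.trans (by norm_num)⟩
      · have h := (tl2223OPAx8Sub_1_1 hΔ' ha' hb hc hν).2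
        exact ⟨le_trans (by norm_num) h.1, h.2.trans (by norm_num)⟩

end Summit.Ventures.CertifiedManyBodySolver.Downfold.Emery
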